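import Summits.Ventures.QEC.CircuitDistance.PortSectorFinal
import HarnessLib

/-!
# P3-PORT (E6): FAST COVERAGE CHECK `covers₁` (candidate translations from the word; null columns by a sorted merge) and the
# sector theorems with SEMANTIC coverage hypotheses (cell `qec`, experiment CDX, seat qec-cdx-type-1)

`covers₀` enumerates all `42 × ℓm` (kind, base index) pairs per word generator; at `[[144,12,12]]` that is `> 600 s` of kernel
time per leaf.  `covers₁` enumerates, per word generator `g` and kind `k` with class `g₀`, only the `≤ 9` candidate shifts
`q − q₀` (`q₀ ∈ g₀`, `q ∈ g`) — complete because `trQ i g₀ = g` forces `i = (q₀ + i) − q₀` — and checks the null columns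
(budget `≠ 0` only) by a duplicate-tolerant merge of sorted column keys (`Finset.sort`, injective).  Soundness:
`xcovers₁_sound` / `zcovers₁_sound : covers₁ = true → Fibre.Covers₀ …`; the sector theorems `no_xLogical_of_leavesC` /
`no_zLogical_of_leavesC` take the semantic `Fibre.Covers₀` per leaf (so either checker can feed them).
-/

namespace Summit.Ventures.QEC.CircuitDistance

open Literature.InformationTheory.QuantumCodes

variable {ℓ m : ℕ}

/-! ## Candidate shifts -/

section NZ

variable [NeZero ℓ] [NeZero m]

/-- Position difference of two qubits in the same block (junk across blocks). -/
def pdiff : BB.Mono ℓ m ⊕ BB.Mono ℓ m → BB.Mono ℓ m ⊕ BB.Mono ℓ m → BB.Mono ℓ m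
  | Sum.inl p, Sum.inl p₀ => p - p₀
  | Sum.inr p, Sum.inr p₀ => p - p₀
  | Sum.inl p, Sum.inr p₀ => p - p₀
  | Sum.inr p, Sum.inl p₀ => p - p₀

/-- The shift is recovered from one translated point. -/
theorem pdiff_translate (i : BB.Mono ℓ m) (q₀ : BB.Mono ℓ m ⊕ BB.Mono ℓ m) : pdiff (BB.Code.translate i q₀) q₀ = i := by
  rcases q₀ with p | p
  · show p + i - p = i; rw [add_sub_cancel_left]
  · show p + i - p = i; rw [add_sub_cancel_left]

/-- CANDIDATE SHIFTS taking `g₀` onto `g`: all differences `q − q₀`; everything if `g₀ = ∅`. -/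
def candSet (g₀ g : Finset (BB.Mono ℓ m ⊕ BB.Mono ℓ m)) : Finset (BB.Mono ℓ m) :=
  if g₀ = ∅ then Finset.univ else (g₀ ×ˢ g).image fun qq => pdiff qq.2 qq.1

/-- Completeness of the candidates. -/
theorem mem_candSet {g₀ g : Finset (BB.Mono ℓ m ⊕ BB.Mono ℓ m)} {i : BB.Mono ℓ m} (h : trQ i g₀ = g) : i ∈ candSet g₀ g := by
  unfold candSet
  by_cases h0 : g₀ = ∅
  · rw [if_pos h0]; exact Finset.mem_univ _
  · rw [if_neg h0, Finset.mem_image]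
    obtain ⟨q₀, hq₀⟩ := Finset.nonempty_iff_ne_empty.2 h0
    refine ⟨(q₀, BB.Code.translate i q₀), Finset.mem_product.2 ⟨hq₀, ?_⟩, pdiff_translate i q₀⟩
    rw [← h, mem_trQ, Equiv.symm_apply_apply]; exact hq₀

end NZ

/-! ## Sorted-merge inclusion of key lists -/

/-- Drop the leading copies of `b`. -/
def dropEq (b : List ℕ) : List (List ℕ) → List (List ℕ)
  | [] => []
  | a :: as => if a = b then dropEq b as else a :: as

/-- What `dropEq` drops equals `b`. -/
theorem mem_dropEq_or (b : List ℕ) : ∀ (l : List (List ℕ)) (x : List ℕ), x ∈ l → x = b ∨ x ∈ dropEq b l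
  | [], x, hx => absurd hx List.not_mem_nil
  | a :: as, x, hx => by
    unfold dropEq
    by_cases hab : a = b
    · rw [if_pos hab]
      rcases List.mem_cons.1 hx with rfl | hx
      · exact Or.inl hab
      · exact mem_dropEq_or b as x hx
    · rw [if_neg hab]; exact Or.inr hx

/-- DUPLICATE-TOLERANT MERGE INCLUSION: walking the right list, drop equal heads on the left; succeed iff the left empties. -/
def subsetSorted : List (List ℕ) → List (List ℕ) → Bool
  | l₁, [] => l₁.isEmpty
  | l₁, b :: bs => subsetSorted (dropEq b l₁) bs

/-- Soundness of the merge inclusion (no sortedness needed). -/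
theorem mem_of_subsetSorted : ∀ (l₂ l₁ : List (List ℕ)), subsetSorted l₁ l₂ = true → ∀ x ∈ l₁, x ∈ l₂
  | [], l₁, h, x, hx => by
    unfold subsetSorted at h; rw [List.isEmpty_iff] at h; rw [h] at hx; exact absurd hx List.not_mem_nil
  | b :: bs, l₁, h, x, hx => by
    unfold subsetSorted at h
    rcases mem_dropEq_or b l₁ x hx with rfl | hx'
    · exact List.mem_cons_self
    · exact List.mem_cons_of_mem _ (mem_of_subsetSorted bs _ h x hx')

/-- Lexicographic comparator on keys (only used to sort; no property needed). -/
def lexLe : List ℕ → List ℕ → Bool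
  | [], _ => true
  | _ :: _, [] => false
  | a :: as, b :: bs => decide (a < b) || (a == b && lexLe as bs)

/-- The KEY of an encoded column: its sorted element list (injective). -/
def colKey (s : Finset ℕ) : List ℕ := s.sort (· ≤ ·)

/-- Keys are injective. -/
theorem colKey_inj {s t : Finset ℕ} (h : colKey s = colKey t) : s = t := by
  ext a; rw [← Finset.mem_sort (· ≤ ·), ← Finset.mem_sort (α := ℕ) (· ≤ ·) (s := t)]
  unfold colKey at h; rw [h]

/-- The keys of a leaf's null coordinates. -/
def leafNullKeys (L : Fibre.Leaf) : List (List ℕ) := L.nulls.map fun c => colKey (L.coordsOf c).toFinset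

/-- A key among the leaf's null keys names a null coordinate. -/
theorem exists_null_of_mem_leafNullKeys (L : Fibre.Leaf) {key : List ℕ} (h : key ∈ leafNullKeys L) :
    ∃ c ∈ L.nulls, colKey (L.coordsOf c).toFinset = key := by
  unfold leafNullKeys at h; exact List.mem_map.1 h

section NZ2

variable [NeZero ℓ] [NeZero m]

/-! ## The fast checks -/

/-- Keys of all non-empty NULL-class columns of the `Nc`-circuit (`X` table). -/
def XTable.nullKeys (S : SMCode ℓ m) (T : XTable ℓ m) (Nc : ℕ) : List (List ℕ) :=
  (XKind.all.product (monoList ℓ m)).flatMap fun ki =>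
    match T.cls ki.1 with
    | some _ => []
    | none => (List.range Nc).filterMap fun c0 =>
        if T.detFast S Nc ki.1 ki.2 (c0 + 1) = ∅ then none
        else some (colKey ((T.detFast S Nc ki.1 ki.2 (c0 + 1)).image encDet))

/-- Keys of all non-empty NULL-class columns of the `Nc`-circuit (`Z` table). -/
def ZTable.nullKeys (S : SMCode ℓ m) (T : ZTable ℓ m) (Nc : ℕ) : List (List ℕ) :=
  (ZKind.all.product (monoList ℓ m)).flatMap fun ki =>
    match T.cls ki.1 with
    | some _ => []
    | none => (List.range Nc).filterMap fun c0 =>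
        if T.detFast S ki.1 ki.2 (c0 + 1) = ∅ then none
        else some (colKey ((T.detFast S ki.1 ki.2 (c0 + 1)).image encDet))

/-- FAST DECIDABLE COVERAGE CHECK (`X`). -/
def XTable.covers₁ (S : SMCode ℓ m) (T : XTable ℓ m) (Nc : ℕ) (e : LeafEntry ℓ m) : Bool :=
  decide (e.word.length = e.leaf.k) &&
  ((List.range e.word.length).all fun j => XKind.all.all fun k =>
    match T.cls k with
    | none => true
    | some g₀ => decide (∀ i ∈ candSet g₀ (e.word.getD j ∅), trQ i g₀ = e.word.getD j ∅ →
        ∀ c0 < Nc, ∃ c ∈ e.leaf.group j, (e.leaf.coordsOf c).toFinset = (T.detFast S Nc k i (c0 + 1)).image encDet)) &&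
  (decide (e.leaf.budget = 0) || subsetSorted ((T.nullKeys S Nc).mergeSort lexLe) ((leafNullKeys e.leaf).mergeSort lexLe))

/-- FAST DECIDABLE COVERAGE CHECK (`Z`). -/
def ZTable.covers₁ (S : SMCode ℓ m) (T : ZTable ℓ m) (Nc : ℕ) (e : LeafEntry ℓ m) : Bool :=
  decide (e.word.length = e.leaf.k) &&
  ((List.range e.word.length).all fun j => ZKind.all.all fun k =>
    match T.cls k with
    | none => true
    | some g₀ => decide (∀ i ∈ candSet g₀ (e.word.getD j ∅), trQ i g₀ = e.word.getD j ∅ →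
        ∀ c0 < Nc, ∃ c ∈ e.leaf.group j, (e.leaf.coordsOf c).toFinset = (T.detFast S k i (c0 + 1)).image encDet)) &&
  (decide (e.leaf.budget = 0) || subsetSorted ((T.nullKeys S Nc).mergeSort lexLe) ((leafNullKeys e.leaf).mergeSort lexLe))

/-! ## Soundness -/

/-- **Fast coverage soundness** (`X`). -/
theorem xcovers₁_sound (S : SMCode ℓ m) (T : XTable ℓ m) (hS : T.ShapeCorrect S) (Nc : ℕ) (e : LeafEntry ℓ m)
    (h : T.covers₁ S Nc e = true) : Fibre.Covers₀ (xDEM S T Nc) (scope Nc) encDet e.word e.leaf := by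
  unfold XTable.covers₁ at h
  simp only [Bool.and_eq_true, decide_eq_true_eq, List.all_eq_true, List.mem_range, Bool.or_eq_true] at h
  obtain ⟨⟨hlen, hall⟩, hnull⟩ := h
  refine ⟨encDet_injective, hlen, fun f hf j hcls => ?_, ?_⟩
  · obtain ⟨h₁, h₂⟩ := hf
    change (f.xKind.bind fun ki => (T.cls ki.1).map (trQ ki.2)) = some e.word[j] at hcls
    rcases hk : f.xKind with _ | ⟨k, i⟩
    · rw [hk] at hcls; simp at hcls
    · rw [hk, Option.bind_some] at hcls
      have hkall : k ∈ XKind.all := XKind.mem_all k (fun lay => Fault.xKind_ne_zero hk lay)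
      have hjk := hall j j.2 k hkall
      rcases hc : T.cls k with _ | g₀
      · rw [hc] at hcls; simp at hcls
      · rw [hc] at hcls hjk
        simp only [Option.map_some, Option.some.injEq] at hcls
        simp only [decide_eq_true_eq] at hjk
        have hwd : e.word.getD (j : ℕ) ∅ = e.word[j] := List.getD_eq_getElem _ _ j.2
        rw [hwd] at hjk
        obtain ⟨c, hc', hcc⟩ := hjk i (mem_candSet hcls) hcls (f.cyc - 1) (by omega)
        refine ⟨c, hc', ?_⟩
        rw [hcc, Nat.sub_add_cancel h₁, XTable.detFast_eq_xDet (hS k hkall) Nc i f.cyc h₁ h₂, ← xDet_eq_of_xKind S Nc f hk]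
        rfl
  · by_cases hb : e.leaf.budget = 0
    · exact Or.inl hb
    · refine Or.inr fun f hf hcls => ?_
      rcases hnull with hnull | hnull
      · exact absurd hnull hb
      obtain ⟨h₁, h₂⟩ := hf
      change (f.xKind.bind fun ki => (T.cls ki.1).map (trQ ki.2)) = none at hcls
      rcases hk : f.xKind with _ | ⟨k, i⟩
      · exact Or.inl (xDet_eq_empty_of_xKind S Nc f hk)
      · rw [hk, Option.bind_some] at hcls
        have hkall : k ∈ XKind.all := XKind.mem_all k (fun lay => Fault.xKind_ne_zero hk lay)
        have hcn : T.cls k = none := by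
          rcases hc : T.cls k with _ | g₀
          · rfl
          · rw [hc] at hcls; simp at hcls
        have hcol : T.detFast S Nc k i (f.cyc - 1 + 1) = xDet S Nc f := by
          rw [Nat.sub_add_cancel h₁, XTable.detFast_eq_xDet (hS k hkall) Nc i f.cyc h₁ h₂, ← xDet_eq_of_xKind S Nc f hk]
        by_cases he : xDet S Nc f = ∅
        · exact Or.inl he
        · right
          have hkey : colKey ((xDet S Nc f).image encDet) ∈ T.nullKeys S Nc := by
            unfold XTable.nullKeys
            rw [List.mem_flatMap]
            refine ⟨(k, i), List.pair_mem_product.2 ⟨hkall, mem_monoList i⟩, ?_⟩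
            simp only [hcn]
            rw [List.mem_filterMap]
            refine ⟨f.cyc - 1, List.mem_range.2 (by omega), ?_⟩
            rw [hcol, if_neg he]
          have hsub := mem_of_subsetSorted _ _ hnull _ ((List.mem_mergeSort).2 hkey)
          rw [List.mem_mergeSort] at hsub
          obtain ⟨c, hcn', hck⟩ := exists_null_of_mem_leafNullKeys e.leaf hsub
          exact ⟨c, hcn', by rw [colKey_inj hck]; rfl⟩

/-- **Fast coverage soundness** (`Z`). -/
theorem zcovers₁_sound (S : SMCode ℓ m) (T : ZTable ℓ m) (hS : T.ShapeCorrect S) (Nc : ℕ) (e : LeafEntry ℓ m)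
    (h : T.covers₁ S Nc e = true) : Fibre.Covers₀ (zDEM S T Nc) (scope Nc) encDet e.word e.leaf := by
  unfold ZTable.covers₁ at h
  simp only [Bool.and_eq_true, decide_eq_true_eq, List.all_eq_true, List.mem_range, Bool.or_eq_true] at h
  obtain ⟨⟨hlen, hall⟩, hnull⟩ := h
  refine ⟨encDet_injective, hlen, fun f hf j hcls => ?_, ?_⟩
  · obtain ⟨h₁, h₂⟩ := hf
    change (f.zKind.bind fun ki => (T.cls ki.1).map (trQ ki.2)) = some e.word[j] at hcls
    rcases hk : f.zKind with _ | ⟨k, i⟩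
    · rw [hk] at hcls; simp at hcls
    · rw [hk, Option.bind_some] at hcls
      have hkall : k ∈ ZKind.all := ZKind.mem_all k (fun lay => Fault.zKind_ne_zero hk lay)
      have hjk := hall j j.2 k hkall
      rcases hc : T.cls k with _ | g₀
      · rw [hc] at hcls; simp at hcls
      · rw [hc] at hcls hjk
        simp only [Option.map_some, Option.some.injEq] at hcls
        simp only [decide_eq_true_eq] at hjk
        have hwd : e.word.getD (j : ℕ) ∅ = e.word[j] := List.getD_eq_getElem _ _ j.2
        rw [hwd] at hjk
        obtain ⟨c, hc', hcc⟩ := hjk i (mem_candSet hcls) hcls (f.cyc - 1) (by omega)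
        refine ⟨c, hc', ?_⟩
        rw [hcc, Nat.sub_add_cancel h₁, ZTable.detFast_eq_zDet (hS k hkall) Nc i f.cyc h₁ h₂, ← zDet_eq_of_zKind S Nc f hk]
        rfl
  · by_cases hb : e.leaf.budget = 0
    · exact Or.inl hb
    · refine Or.inr fun f hf hcls => ?_
      rcases hnull with hnull | hnull
      · exact absurd hnull hb
      obtain ⟨h₁, h₂⟩ := hf
      change (f.zKind.bind fun ki => (T.cls ki.1).map (trQ ki.2)) = none at hcls
      rcases hk : f.zKind with _ | ⟨k, i⟩
      · exact Or.inl (zDet_eq_empty_of_zKind S Nc f hk)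
      · rw [hk, Option.bind_some] at hcls
        have hkall : k ∈ ZKind.all := ZKind.mem_all k (fun lay => Fault.zKind_ne_zero hk lay)
        have hcn : T.cls k = none := by
          rcases hc : T.cls k with _ | g₀
          · rfl
          · rw [hc] at hcls; simp at hcls
        have hcol : T.detFast S k i (f.cyc - 1 + 1) = zDet S Nc f := by
          rw [Nat.sub_add_cancel h₁, ZTable.detFast_eq_zDet (hS k hkall) Nc i f.cyc h₁ h₂, ← zDet_eq_of_zKind S Nc f hk]
        by_cases he : zDet S Nc f = ∅
        · exact Or.inl he
        · right
          have hkey : colKey ((zDet S Nc f).image encDet) ∈ T.nullKeys S Nc := by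
            unfold ZTable.nullKeys
            rw [List.mem_flatMap]
            refine ⟨(k, i), List.pair_mem_product.2 ⟨hkall, mem_monoList i⟩, ?_⟩
            simp only [hcn]
            rw [List.mem_filterMap]
            refine ⟨f.cyc - 1, List.mem_range.2 (by omega), ?_⟩
            rw [hcol, if_neg he]
          have hsub := mem_of_subsetSorted _ _ hnull _ ((List.mem_mergeSort).2 hkey)
          rw [List.mem_mergeSort] at hsub
          obtain ⟨c, hcn', hck⟩ := exists_null_of_mem_leafNullKeys e.leaf hsub
          exact ⟨c, hcn', by rw [colKey_inj hck]; rfl⟩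

/-! ## Sector theorems with semantic coverage -/

/-- **`X`-SECTOR THEOREM with SEMANTIC coverage** (`Fibre.Covers₀` per leaf; feed it from `xcovers₀_sound` or
`xcovers₁_sound`). -/
theorem no_xLogical_of_leavesC (S : SMCode ℓ m) (T : XTable ℓ m) (hS : T.ShapeCorrect S) (hC : T.ClassCorrect S)
    (N₀ w : ℕ) (leaves : List (LeafEntry ℓ m))
    (hwf : ∀ e ∈ leaves, e.leaf.wf = true ∧ Fibre.Covers₀ (xDEM S T N₀) (scope N₀) encDet e.word e.leaf ∧ e.word.Nodup ∧ e.leaf.w = w ∧ e.leaf.budget ≤ 1 ∧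
      ¬ e.leaf.Realised)
    (hcomplete : ∀ x : Finset (Finset (BB.Mono ℓ m ⊕ BB.Mono ℓ m)), (∀ g ∈ x, IsXClass T g) →
      XNontrivial S (∑ g ∈ x, indic g) → x.card ≤ w → ∃ e ∈ leaves, ∃ t : BB.Mono ℓ m, x = (e.word.map (trQ t)).toFinset) :
    ¬ ∃ F : Finset (Fault ℓ m), Undetectable S N₀ F ∧ dataX S N₀ F ∉ rowSpace S.toCode.HX ∧ faultCount F ≤ w := by
  classical
  rintro ⟨F, hU, hL, hw⟩
  obtain ⟨F₁, hR, hcard, himg, hX, hZ, hdX, hdZ⟩ := exists_reduced S N₀ F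
  have hU₁ : Undetectable S N₀ F₁ := by
    refine ⟨fun f' hf' => ?_, fun t i => ⟨?_, ?_⟩⟩
    · have : f'.loc ∈ F.image Fault.loc := himg (Finset.mem_image_of_mem _ hf')
      obtain ⟨f, hf, hfl⟩ := Finset.mem_image.1 this
      rw [← Fault.ev_eq_of_loc_eq hfl]; exact hU.1 f hf
    · rw [hX]; exact (hU.2 t i).1
    · rw [hZ]; exact (hU.2 t i).2
  have hNT : XNontrivial S (dataX S N₀ F₁) := ⟨(residual_syndrome_zero S N₀ F₁ hU₁).1, by rw [hdX]; exact hL⟩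
  have hscope : ∀ f ∈ F₁, f ∈ scope (ℓ := ℓ) (m := m) N₀ := by
    intro f hf
    have := hU₁.1 f hf
    rw [mem_allEvents_iff, Fault.ev_cyc] at this
    exact this
  have key := Fibre.no_silent_nontrivial (xDEM S T N₀) (scope N₀) (classHyp_xDEM S T hS hC N₀) (XNontrivial S)
    (fun v s hs => xNontrivial_add_stab S v s hs) w ?_ F₁ hscope (hcard.trans hw) (silent_xDEM S T N₀ F₁ hU₁)
  · apply key
    show XNontrivial S (∑ f ∈ F₁, dataX S N₀ {f})
    rw [← dataX_eq_sum]; exact hNT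
  intro x hx hxw
  by_cases hcl : ∀ g ∈ x, IsXClass T g
  · obtain ⟨e, he, t, rfl⟩ := hcomplete x hcl hx hxw
    obtain ⟨hwfe, hcov, hnd, hwe, hb, hnr⟩ := hwf e he
    have hcovers := hcov
    have hlen : e.word.length = e.leaf.k := hcovers.2.1
    rw [word_map_toFinset, Finset.card_map, List.toFinset_card_of_nodup hnd, hlen]
    show ¬ Fibre.TightRealisable (xDEM S T N₀) (scope N₀) (e.word.toFinset.map (xSymm S T N₀ t).onGen.toEmbedding) _
    rw [Fibre.tightRealisable_map_iff (xDEM S T N₀) (scope N₀) (xSymm S T N₀ t)]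
    have hbud : w - e.leaf.k = e.leaf.budget := by unfold Fibre.Leaf.budget; rw [hwe]
    rw [hbud]
    exact Fibre.not_tightRealisable_of_notRealised₀ (xDEM S T N₀) (scope N₀) encDet e.word hnd e.leaf hcovers hnr hb
  · -- a non-class word is never realised
    push Not at hcl
    obtain ⟨g, hgx, hg⟩ := hcl
    rintro ⟨G, -, -, hproj, -⟩
    have hgp : g ∈ Fibre.proj (xDEM S T N₀) G := by rw [hproj]; exact hgx
    obtain ⟨f, -, hf⟩ := isClass_of_mem_proj (xDEM S T N₀) G g hgp
    exact hg (isXClass_of_cls S T N₀ f g hf)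

/-- **`Z`-SECTOR THEOREM with SEMANTIC coverage.** -/
theorem no_zLogical_of_leavesC (S : SMCode ℓ m) (T : ZTable ℓ m) (hS : T.ShapeCorrect S) (hC : T.ClassCorrect S)
    (N₀ w : ℕ) (leaves : List (LeafEntry ℓ m))
    (hwf : ∀ e ∈ leaves, e.leaf.wf = true ∧ Fibre.Covers₀ (zDEM S T N₀) (scope N₀) encDet e.word e.leaf ∧ e.word.Nodup ∧ e.leaf.w = w ∧ e.leaf.budget ≤ 1 ∧
      ¬ e.leaf.Realised)
    (hcomplete : ∀ x : Finset (Finset (BB.Mono ℓ m ⊕ BB.Mono ℓ m)), (∀ g ∈ x, IsZClass T g) →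
      ZNontrivial S (∑ g ∈ x, indic g) → x.card ≤ w → ∃ e ∈ leaves, ∃ t : BB.Mono ℓ m, x = (e.word.map (trQ t)).toFinset) :
    ¬ ∃ F : Finset (Fault ℓ m), Undetectable S N₀ F ∧ dataZ S N₀ F ∉ rowSpace S.toCode.HZ ∧ faultCount F ≤ w := by
  classical
  rintro ⟨F, hU, hL, hw⟩
  obtain ⟨F₁, hR, hcard, himg, hX, hZ, hdX, hdZ⟩ := exists_reduced S N₀ F
  have hU₁ : Undetectable S N₀ F₁ := by
    refine ⟨fun f' hf' => ?_, fun t i => ⟨?_, ?_⟩⟩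
    · have : f'.loc ∈ F.image Fault.loc := himg (Finset.mem_image_of_mem _ hf')
      obtain ⟨f, hf, hfl⟩ := Finset.mem_image.1 this
      rw [← Fault.ev_eq_of_loc_eq hfl]; exact hU.1 f hf
    · rw [hX]; exact (hU.2 t i).1
    · rw [hZ]; exact (hU.2 t i).2
  have hNT : ZNontrivial S (dataZ S N₀ F₁) := ⟨(residual_syndrome_zero S N₀ F₁ hU₁).2, by rw [hdZ]; exact hL⟩
  have hscope : ∀ f ∈ F₁, f ∈ scope (ℓ := ℓ) (m := m) N₀ := by
    intro f hf
    have := hU₁.1 f hf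
    rw [mem_allEvents_iff, Fault.ev_cyc] at this
    exact this
  have key := Fibre.no_silent_nontrivial (zDEM S T N₀) (scope N₀) (classHyp_zDEM S T hS hC N₀) (ZNontrivial S)
    (fun v s hs => zNontrivial_add_stab S v s hs) w ?_ F₁ hscope (hcard.trans hw) (silent_zDEM S T N₀ F₁ hU₁)
  · apply key
    show ZNontrivial S (∑ f ∈ F₁, dataZ S N₀ {f})
    rw [← dataZ_eq_sum]; exact hNT
  intro x hx hxw
  by_cases hcl : ∀ g ∈ x, IsZClass T g
  · obtain ⟨e, he, t, rfl⟩ := hcomplete x hcl hx hxw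
    obtain ⟨hwfe, hcov, hnd, hwe, hb, hnr⟩ := hwf e he
    have hcovers := hcov
    have hlen : e.word.length = e.leaf.k := hcovers.2.1
    rw [word_map_toFinset, Finset.card_map, List.toFinset_card_of_nodup hnd, hlen]
    show ¬ Fibre.TightRealisable (zDEM S T N₀) (scope N₀) (e.word.toFinset.map (zSymm S T N₀ t).onGen.toEmbedding) _
    rw [Fibre.tightRealisable_map_iff (zDEM S T N₀) (scope N₀) (zSymm S T N₀ t)]
    have hbud : w - e.leaf.k = e.leaf.budget := by unfold Fibre.Leaf.budget; rw [hwe]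
    rw [hbud]
    exact Fibre.not_tightRealisable_of_notRealised₀ (zDEM S T N₀) (scope N₀) encDet e.word hnd e.leaf hcovers hnr hb
  · push Not at hcl
    obtain ⟨g, hgx, hg⟩ := hcl
    rintro ⟨G, -, -, hproj, -⟩
    have hgp : g ∈ Fibre.proj (zDEM S T N₀) G := by rw [hproj]; exact hgx
    obtain ⟨f, -, hf⟩ := isClass_of_mem_proj (zDEM S T N₀) G g hgp
    exact hg (isZClass_of_cls S T N₀ f g hf)

end NZ2

end Summit.Ventures.QEC.CircuitDistance
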